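import Summits.Ventures.CertifiedManyBodySolver.Rows.TorusPairDiagDominance
import Summits.Ventures.CertifiedManyBodySolver.Rows.TorusPairSumRule
import Literature.MathematicalPhysics.QuantumLattice.PairCorrelationsProofs
import Mathlib.Order.LiminfLimsup
import HarnessLib

/-!
# The uniform-in-`r` input on the finite tori: a TAIL bound on the translation-averaged pair correlator
# is a ceiling on the pair-field density, hence on the `liminf` of `HubbardSuperconductivity`'s LRO sequence

HONEST FRAMING: first certified bounds on pairing observables; not a superconductivity verdict; every
number certified (two lineages + referee) or labelled float. Crew hubbard-obs (D-0042), seat hubbard-obs-p1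
(`prover-hubbard-obs-p1-g2-0`), lead ruling (ao1) («… PLUS a uniform-in-`r` input that no finite SDP supplies by
itself — an analytic clustering lemma = a genuine crux»). Summit-format twin of `Observables/PairTailCeiling.lean`
(which is the thermodynamic-limit / Bragg-weight form). Elementary (the torus pair sum rule
`TorusPair.sum_halfOpenBox_avgPairCorr` and diagonal dominance `TorusPair.abs_avgPairCorr_le_avgPairCorr_zero`);
zero compute; no named fact; no definition; no `sorry`.

* `pairFieldDensity_le_of_tail_bound` — ONE torus, EVERY vector `ψ`: if `P̄_d(L, r; ψ) ≤ η` (`η ≥ 0`) for every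
  displacement `r` of the fundamental domain `halfOpenBox 2 L` outside an exceptional set `N` (the short-range
  displacements, in any convention), then `p_d(L; ψ) ≤ η + #N · P̄_d(L, 0; ψ) / L²`
  (`L² p_d = Σ_r P̄_d(r)`, the `N`-terms are `≤ P̄_d(0)` each, the others `≤ η`).
* **`liminf_dWavePairFieldLRO_le_of_tail_bound`** — a FAMILY `ψ_L` with a tail bound `P̄_d(L, r; ψ_L) ≤ η` off
  exceptional sets of UNIFORMLY bounded size `#N_L ≤ K` (all `L ≥ L₀`) and a uniform local bound
  `P̄_d(L, 0; ψ_L) ≤ c₀`: the summit's sequence `u_k = |Λ_{2k}|⁻² Σ_{x,y} P_d(2k; x, y) = p_d(2k; ψ_{2k})` obeys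
  **`liminf_k u_k ≤ η`** (indeed it is eventually `≤ η + K c₀/(2k)²`).
This is the exact shape of the missing analytic input: a decay/clustering statement for the sector ground states,
uniform in `r` beyond a fixed range and in `L`, converts into the LRO ceiling that `PairBoxCeilingSharpness.lean`
shows no finite family of certified cells can deliver. HONEST: no tail bound is supplied here.

References: Scalapino, Phys. Rep. 250 (1995) 329, §2 eq. (2.4); Yang, Rev. Mod. Phys. 34 (1962) 694 §3.
-/

noncomputable section

namespace Summit.Ventures.CertifiedManyBodySolver.Observables

open Matrix Finset Filter Topology Literature.Probability.LatticeModels Literature.MathematicalPhysics.QuantumLattice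
open Summit.HubbardSuperconductivity.HubbardLadder Summit.Ventures.CertifiedManyBodySolver.TorusPair
open scoped ComplexOrder BigOperators

/-! ## §1  One torus, every vector -/

/-- **Tail bound ⇒ pair-field density ceiling (one torus, every vector).** For `L ≥ 1`, `η ≥ 0`, an exceptional
set `N ⊆ ℤ²` and a vector `ψ` with `P̄_d(L, r; ψ) ≤ η` for every `r ∈ halfOpenBox 2 L ∖ N`:
`p_d(L; ψ) ≤ η + #N · P̄_d(L, 0; ψ) / L²`. [cite: Scalapino1995, §2 eq. (2.4)] -/
theorem pairFieldDensity_le_of_tail_bound {L : ℕ} (hL : 1 ≤ L) (ψ : Fock (Orb (FermionTorus 2 L)))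
    {η : ℝ} (hη : 0 ≤ η) (N : Finset (Site 2))
    (htail : ∀ r ∈ halfOpenBox 2 L, r ∉ N → avgPairCorr L r ψ ≤ η) :
    pairFieldDensity L ψ ≤ η + (N.card : ℝ) * avgPairCorr L 0 ψ / (L : ℝ) ^ 2 := by
  have hL2 : (0 : ℝ) < (L : ℝ) ^ 2 := by positivity
  have hsum := sum_halfOpenBox_avgPairCorr L ψ
  -- split the fundamental domain into `N`-displacements and the tail
  have hsplit : ∑ r ∈ halfOpenBox 2 L, avgPairCorr L r ψ =
      ∑ r ∈ (halfOpenBox 2 L).filter (fun r => r ∈ N), avgPairCorr L r ψ +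
        ∑ r ∈ (halfOpenBox 2 L).filter (fun r => r ∉ N), avgPairCorr L r ψ :=
    (Finset.sum_filter_add_sum_filter_not _ (fun r => r ∈ N) _).symm
  have h0 := avgPairCorr_zero_nonneg L ψ
  have hnear : ∑ r ∈ (halfOpenBox 2 L).filter (fun r => r ∈ N), avgPairCorr L r ψ ≤
      (N.card : ℝ) * avgPairCorr L 0 ψ := by
    calc ∑ r ∈ (halfOpenBox 2 L).filter (fun r => r ∈ N), avgPairCorr L r ψ
        ≤ ∑ _r ∈ (halfOpenBox 2 L).filter (fun r => r ∈ N), avgPairCorr L 0 ψ :=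
          Finset.sum_le_sum fun r _ => (le_abs_self _).trans (abs_avgPairCorr_le_avgPairCorr_zero L r ψ)
      _ = (((halfOpenBox 2 L).filter (fun r => r ∈ N)).card : ℝ) * avgPairCorr L 0 ψ := by
          rw [Finset.sum_const, nsmul_eq_mul]
      _ ≤ (N.card : ℝ) * avgPairCorr L 0 ψ := by
          refine mul_le_mul_of_nonneg_right ?_ h0
          exact_mod_cast Finset.card_le_card (fun r hr => (Finset.mem_filter.1 hr).2)
  have hfar : ∑ r ∈ (halfOpenBox 2 L).filter (fun r => r ∉ N), avgPairCorr L r ψ ≤ (L : ℝ) ^ 2 * η := by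
    calc ∑ r ∈ (halfOpenBox 2 L).filter (fun r => r ∉ N), avgPairCorr L r ψ
        ≤ ∑ _r ∈ (halfOpenBox 2 L).filter (fun r => r ∉ N), η :=
          Finset.sum_le_sum fun r hr => htail r (Finset.mem_filter.1 hr).1 (Finset.mem_filter.1 hr).2
      _ = (((halfOpenBox 2 L).filter (fun r => r ∉ N)).card : ℝ) * η := by
          rw [Finset.sum_const, nsmul_eq_mul]
      _ ≤ (L : ℝ) ^ 2 * η := by
          refine mul_le_mul_of_nonneg_right ?_ hη
          have h := Finset.card_le_card (Finset.filter_subset (fun r => r ∉ N) (halfOpenBox 2 L))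
          rw [card_halfOpenBox] at h
          exact_mod_cast h
  have hkey : (L : ℝ) ^ 2 * pairFieldDensity L ψ ≤ (L : ℝ) ^ 2 * η + (N.card : ℝ) * avgPairCorr L 0 ψ := by
    rw [← hsum, hsplit]
    linarith
  rw [add_div' _ _ _ hL2.ne', le_div_iff₀ hL2]
  linarith

/-! ## §2  Families of vectors: the summit-format `liminf` ceiling -/

/-- **TAIL bound ⇒ ceiling on the `liminf` of the summit's pair-field LRO sequence.** Let `ψ_L` be any family
of torus vectors (e.g. unit sector ground states), `η ≥ 0`, and suppose that for all `L ≥ L₀` the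
translation-averaged `d`-wave pair correlator obeys `P̄_d(L, r; ψ_L) ≤ η` for every `r ∈ halfOpenBox 2 L` outside
an exceptional set `N_L` with `#N_L ≤ K`, and `P̄_d(L, 0; ψ_L) ≤ c₀` (uniform local bound). Then the sequence
`u_k = |Λ_{2k}|⁻² Σ_{x,y∈Λ_{2k}} P_d(2k; x, y)` of `HubbardSuperconductivity` (even tori) satisfies
`liminf_k u_k ≤ η`. [cite: Scalapino1995, §2 eq. (2.4)] -/
theorem liminf_dWavePairFieldLRO_le_of_tail_bound (ψ : ∀ L, Fock (Orb (FermionTorus 2 L)))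
    {η K c₀ : ℝ} (hη : 0 ≤ η) (hK : 0 ≤ K) (L₀ : ℕ) (N : ℕ → Finset (Site 2))
    (hN : ∀ L, L₀ ≤ L → ((N L).card : ℝ) ≤ K)
    (h0 : ∀ L, L₀ ≤ L → avgPairCorr L 0 (ψ L) ≤ c₀)
    (htail : ∀ L, L₀ ≤ L → ∀ r ∈ halfOpenBox 2 L, r ∉ N L → avgPairCorr L r (ψ L) ≤ η) :
    liminf (fun k : ℕ => (∑ x ∈ halfOpenBox 2 (2 * k), ∑ y ∈ halfOpenBox 2 (2 * k),
        torusPullback (pairFieldCorr dWaveFormFactor ψ) (2 * k) x y) /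
          ((#(halfOpenBox 2 (2 * k)) : ℝ)) ^ 2) atTop ≤ η := by
  set useq : ℕ → ℝ := fun k => (∑ x ∈ halfOpenBox 2 (2 * k), ∑ y ∈ halfOpenBox 2 (2 * k),
      torusPullback (pairFieldCorr dWaveFormFactor ψ) (2 * k) x y) /
        ((#(halfOpenBox 2 (2 * k)) : ℝ)) ^ 2 with huseq
  change liminf useq atTop ≤ η
  -- the `k`-th term (for `k ≥ 1`) is the pair-field density of `ψ_{2k}`
  have hterm : ∀ k : ℕ, 1 ≤ k → useq k = pairFieldDensity (2 * k) (ψ (2 * k)) := by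
    intro k hk
    obtain ⟨m, hm⟩ : ∃ m, 2 * k = m + 1 := ⟨2 * k - 1, by omega⟩
    simp only [huseq]
    rw [hm, torusLROSeq_pairFieldCorr_succ]
    rfl
  have hnonneg : ∀ k : ℕ, 1 ≤ k → 0 ≤ useq k := fun k hk => by
    rw [hterm k hk]; exact pairFieldDensity_nonneg _ _
  have hbdd : IsBoundedUnder (· ≥ ·) atTop useq :=
    isBoundedUnder_of_eventually_ge (a := 0) (Filter.eventually_atTop.2 ⟨1, fun k hk => hnonneg k hk⟩)
  -- eventually `useq k ≤ η + K c₀ / (2k)²`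
  have hev : ∀ k : ℕ, max 1 L₀ ≤ k → useq k ≤ η + K * c₀ / ((2 * k : ℕ) : ℝ) ^ 2 := by
    intro k hk
    have hk1 : 1 ≤ k := le_trans (le_max_left _ _) hk
    have hkL : L₀ ≤ 2 * k := le_trans (le_trans (le_max_right _ _) hk) (by omega)
    rw [hterm k hk1]
    have hA := pairFieldDensity_le_of_tail_bound (L := 2 * k) (by omega) (ψ (2 * k)) hη (N (2 * k))
      (htail (2 * k) hkL)
    have hpos : (0 : ℝ) < ((2 * k : ℕ) : ℝ) ^ 2 := by positivity
    have hnum : ((N (2 * k)).card : ℝ) * avgPairCorr (2 * k) 0 (ψ (2 * k)) ≤ K * c₀ :=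
      mul_le_mul (hN _ hkL) (h0 _ hkL) (avgPairCorr_zero_nonneg _ _) hK
    have := div_le_div_of_nonneg_right hnum hpos.le
    push_cast at hA this ⊢
    linarith
  -- the comparison sequence tends to `η`
  have hcomp : Tendsto (fun k : ℕ => η + K * c₀ / ((2 * k : ℕ) : ℝ) ^ 2) atTop (𝓝 η) := by
    have h2k : Tendsto (fun k : ℕ => ((2 * k : ℕ) : ℝ)) atTop atTop := by
      refine tendsto_natCast_atTop_atTop.comp ?_
      exact Filter.tendsto_id.const_mul_atTop' (by norm_num)
    have hsq : Tendsto (fun k : ℕ => ((2 * k : ℕ) : ℝ) ^ 2) atTop atTop :=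
      (tendsto_pow_atTop (α := ℝ) two_ne_zero).comp h2k
    have hinv := hsq.inv_tendsto_atTop
    have h1 := (hinv.const_mul (K * c₀)).const_add η
    rw [mul_zero, add_zero] at h1
    refine h1.congr' (Eventually.of_forall fun k => ?_)
    simp [div_eq_mul_inv]
  -- hence for every `ε > 0`, frequently `useq k ≤ η + ε`
  refine le_of_forall_pos_le_add fun ε hε => ?_
  have hevε : ∀ᶠ k : ℕ in atTop, useq k ≤ η + ε := by
    have hlt : ∀ᶠ k : ℕ in atTop, η + K * c₀ / ((2 * k : ℕ) : ℝ) ^ 2 < η + ε :=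
      hcomp.eventually (gt_mem_nhds (by linarith))
    filter_upwards [hlt, Filter.eventually_ge_atTop (max 1 L₀)] with k hk hk'
    exact (hev k hk').trans hk.le
  exact liminf_le_of_frequently_le hevε.frequently hbdd

end Summit.Ventures.CertifiedManyBodySolver.Observables

end
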